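/-
COR-CM (cell pub-hodgecm2, stage 2 of the Hodge ladder) — count-neutral CLOSED FORMS of the odd-slice transport (seat
prover-pub-hodgecm2-b23-g36-0, binder prover b23, gen 36; claim ODD-SLICE-TRANSPORT F2b, HOME/INBOX.md 2026-08-22T05:31:42Z + naming
addendum; sequel of `CorCM/FaceCensusOddSliceTransport.lean`).  Theorems only: the INT2-GEN closed forms of
`CorCM/FacePeriodsGeneratingSet.lean` (`hodgeConjectureFor_of_avDominatedBy_isProductOf_of_{weilFaceAlgebraic,exists_facePeriod}_on`)
fed BY NAME with the generation binder `hgen` of the odd-slice transport (`FaceCensus.OddSlice.hgen_of_hodge_le`), in three shapes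
of the dictionary datum: on `GalT K`, on `Aut(K)`, and — for CYCLIC fields — from ONE generator and `finrank ℚ K = 2m`, `m` odd.  No
definition, no named fact, nothing asserted; `Interfaces.lean` (C1), every E term, B01 and `Transposition/*` are untouched.
HONEST FRAMING (COORDINATOR RULING — HODGE FRAMING CORRECTION, 2026-08-21T11:55:35Z): `HC_CM` is NOT proved, here or anywhere in
the tree.  Every theorem below is CONDITIONAL on (i) a generation statement `hodge A ≤ pairs A ⊔ ℤ[G]·faceVec(S)` in seat b09's
finite model and (ii) one face-period witness (or algebraic Weil line) per face of a set `𝒮` reading `S`, for ONE field `K`; nothing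
is discharged for any particular field here and nothing here produces a period.
T5 (coordinator ruling 15:33:56Z (3)): binder sets = {dictionary datum (inhabited by transport of structure for every Galois CM field
with group `ℤ/2 × A`, resp. derived from `Aut(K)` / from a generator below), `hS` (a statement of b09's model: his
`OddSliceFacesGenerate.hodge_le_pairs_sup_spanFaces_family`, or a certificate), `hreads` (INHABITED: `FaceCensus.OddSlice.exists_faces_read`),
face periods on `𝒮` = instances of the crux (`FacePeriodExists` / B01-S) with no `¬` theorem in the tree on the universe of record}
— no contradiction derivable; checker: self (prover-pub-hodgecm2-b23-g36-0), 2026-08-22.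
-/
import Summits.HodgeConjecture.CorCM.FaceCensusOddSliceTransport
import Summits.HodgeConjecture.CorCM.FaceCensusTransport
import Summits.HodgeConjecture.CorCM.FaceCensusGroupDictionary
import HarnessLib

/-!
# The odd-slice transport, CLOSED on the universe of record: Galois CM fields with group `ℤ/2 × A`, `|A|` odd

For ONE Galois CM field `K` whose group of Galois translates is `ℤ/2 × A` (dictionary datum `θ`, or an `Aut`-datum `ε`, or — `K`
cyclic of degree `2m`, `m` odd — ONE generator `g`), a finite label family `S ⊆ (A → ℤ/2) × A × A` generating the Hodge lattice of
b09's model (`hodge A ≤ pairs A ⊔ span ℤ {transl g (faceVec s)}` — for `|A|` odd this is b09's theorem for his `family A` of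
`#OrbitsA A` faces, `Census/OddSliceFacesGenerate.lean`; any certificate also qualifies), and a set `𝒮` of faces of `K` reading `S`
at a base embedding `σ₀`: ONE period witness per face of `𝒮` on the universe of record (or: the Weil lines of the faces of `𝒮` are
algebraic) implies the Hodge conjecture, in every codimension, for every complex abelian variety dominated by a finite product of
abelian varieties realising CM types of CM fields embeddable in `K`.  No Cayley table, no bitmask, no certificate: the generation
binder is `FaceCensus.OddSlice.hgen_of_hodge_le`.

* §1 dictionary datum on `GalT K`: `…_of_weilFaceAlgebraic_of_oddSlice`, `…_of_exists_facePeriod_of_oddSlice` (headline), and the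
  finite-face-set form `exists_faceSet_of_oddSlice` (a set of at most `|S|` faces whose periods suffice EXISTS, by non-vacuity);
* §2 `Aut`-datum: `…_of_exists_facePeriod_of_oddSlice_aut` (faces described by automorphisms);
* §3 cyclic fields: `…_of_exists_facePeriod_of_oddSlice_gen` — `finrank ℚ K = 2m`, `m` odd, ONE generator `g`; complex conjugation
  is `g^m` automatically (the unique involution maps to `(1, 0) ∈ ℤ/2 × ℤ/m`), faces described by `g`-powers.

References: [cite: Pohlmann1968, Thm. 1]; [cite: Milne1999LefschetzClasses, Thm. 3.2 and Cor. 4.5];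
[cite: Shimura1998, §6.2 Theorem 3 and §6.1 Corollary of Theorem 2 (pp. 41–43)]; [cite: MumfordAV1970, §19 Thm. 1 and p. 169].
-/

noncomputable section

open CategoryTheory NumberField NumberField.ComplexEmbedding
open Literature.AlgebraicGeometry Literature.AlgebraicGeometry.Motives Literature.AlgebraicGeometry.HodgeTheory
open Literature.AlgebraicGeometry.ComplexMultiplication Literature.AlgebraicGeometry.Milne1999
open Literature.NumberTheory.Automorphic
open Literature.NumberTheory.Automorphic.PicardCM
open Summit.HodgeConjecture.CorCM.Domination

namespace Summit.HodgeConjecture.CorCM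

open Summit.HodgeConjecture.CorCM.Census.OddSliceFacesModel (Ty tw transl δ pairVec pairs hodge)
open Summit.HodgeConjecture.CorCM.Census.OddSliceFacesSquares (faceVec)
open Summit.HodgeConjecture.CorCM.FaceCensus.OddSlice

/-! ## §1 Dictionary datum on `GalT K` -/

section GalTDatum

variable {A : Type} [AddCommGroup A] [Fintype A] [DecidableEq A]

omit [AddCommGroup A] [DecidableEq A] in
/-- `[K:ℚ] = 2|A| ≥ 6` when `|A| ≥ 3`. [folklore] -/
theorem six_le_finrank_of_datum (K : CMField) [IsGalois ℚ K] (hA : 3 ≤ Fintype.card A) (θ : GalT K ≃ ZMod 2 × A) :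
    6 ≤ Module.finrank ℚ (K : Type) := by
  rw [← FaceCensus.card_galT, Fintype.card_congr θ, Fintype.card_prod, ZMod.card]
  omega

/-- **THE ODD-SLICE TRANSPORT, CLOSED — Weil-line form.**  For ONE Galois CM field `K` with dictionary datum `θ : GalT K ≃ ℤ/2 × A`
(`|A| ≥ 3`), a label family `S` generating the Hodge lattice of b09's model together with the pairs, and a set `𝒮` of faces of `K`
reading `S` at `σ₀`: if the Weil lines of the faces of `𝒮` are algebraic on the universe of record, then every complex abelian variety
dominated by a finite product of abelian varieties realising CM types of CM fields embeddable in `K` satisfies the Hodge conjecture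
in every codimension.  (FRAMING: conditional; `HC_CM` is not proved.)
[cite: Pohlmann1968, Thm. 1] [cite: Milne1999LefschetzClasses, Thm. 3.2 and Cor. 4.5]
[cite: Shimura1998, §6.2 Theorem 3 and §6.1 Corollary of Theorem 2 (pp. 41–43)] [cite: MumfordAV1970, §19 Thm. 1 and p. 169] -/
theorem hodgeConjectureFor_of_avDominatedBy_isProductOf_of_weilFaceAlgebraic_of_oddSlice (K : CMField) [hGal : IsGalois ℚ K]
    (hA : 3 ≤ Fintype.card A) (θ : GalT K ≃ ZMod 2 × A) (hθ : ∀ P Q : GalT K, θ (P * Q) = θ P + θ Q) (hc : θ conjT = (1, 0))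
    (S : Finset (Ty A × A × A))
    (hS : hodge A ≤ pairs A ⊔
      Submodule.span ℤ {w : Ty A → ℤ | ∃ g : ZMod 2 × A, ∃ s ∈ S, w = transl A g (faceVec A s.1 s.2.1 s.2.2)})
    (σ₀ : (K : Type) →+* ℂ) (𝒮 : Set (Face K))
    (hreads : ∀ s ∈ S, ∃ R ∈ 𝒮, typeMap θ (pullType R.Φ σ₀) = s.1 ∧ (θ (translate σ₀ R.p)).2 = s.2.1 ∧
      (θ (translate σ₀ R.p')).2 = s.2.2)
    (hWeil : ∀ f ∈ 𝒮, (Model.picardCMUniverse exists_isReal_hodgeModel_holds hodgePQ_independent_of_hodgeModel_holds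
      BallQuotient.ballQuotientUniformised_holds cmAbelianVarietyRealised_holds).WeilFaceAlgebraic K f)
    {P B : AbelianVariety ℂ} (hP : AbelianVariety.IsProductOf (fun B : AbelianVariety ℂ =>
      ∃ (E : Type) (_ : Field E) (_ : NumberField E) (_ : IsCMField E) (_ : E →+* (K : Type)) (Φ : CMType E)
        (ι : 𝓞 E →+* End B) (θ : E →+* Module.End ℂ (complexBetti B.X 1)),
        IsCMTypeRealisation Φ B ι θ) P)
    (hB : AVDominatedBy B P) : HodgeConjectureFor B.dim B.X :=
  hodgeConjectureFor_of_avDominatedBy_isProductOf_of_weilFaceAlgebraic_on K (six_le_finrank_of_datum K hA θ) 𝒮 σ₀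
    (hgen_of_hodge_le θ hθ hc S hS σ₀ 𝒮 hreads) hWeil hP hB

/-- **THE ODD-SLICE TRANSPORT, CLOSED — period-witness form (headline).**  For ONE Galois CM field `K` with dictionary datum
`θ : GalT K ≃ ℤ/2 × A` (`|A| ≥ 3`), a label family `S` generating the Hodge lattice of b09's model together with the pairs, and a set
`𝒮` of faces of `K` reading `S` at `σ₀`: ONE period witness per face OF `𝒮` on the universe of record (some admissible `ι₁`, some
hermitian 3-space `V`, some level, eigenforms at some `σ`) implies the Hodge conjecture, in every codimension, for every complex
abelian variety dominated by a finite product of abelian varieties each realising a CM type of a CM field `E` with `E →+* K`.  NO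
Cayley table, NO certificate.  (FRAMING: a statement about the abelian varieties generated by ONE field `K`, conditional on the
face periods of `𝒮` and on the generation statement `hS` of the finite model; `HC_CM` is not proved.)
[cite: Shimura1998, §6.2 Theorem 3 and §6.1 Corollary of Theorem 2 (pp. 41–43)] [cite: Pohlmann1968, Thm. 1]
[cite: Milne1999LefschetzClasses, Thm. 3.2 and Cor. 4.5] [cite: MumfordAV1970, §19 Thm. 1 and p. 169] -/
theorem hodgeConjectureFor_of_avDominatedBy_isProductOf_of_exists_facePeriod_of_oddSlice (K : CMField) [hGal : IsGalois ℚ K]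
    (hA : 3 ≤ Fintype.card A) (θ : GalT K ≃ ZMod 2 × A) (hθ : ∀ P Q : GalT K, θ (P * Q) = θ P + θ Q) (hc : θ conjT = (1, 0))
    (S : Finset (Ty A × A × A))
    (hS : hodge A ≤ pairs A ⊔
      Submodule.span ℤ {w : Ty A → ℤ | ∃ g : ZMod 2 × A, ∃ s ∈ S, w = transl A g (faceVec A s.1 s.2.1 s.2.2)})
    (σ₀ : (K : Type) →+* ℂ) (𝒮 : Set (Face K))
    (hreads : ∀ s ∈ S, ∃ R ∈ 𝒮, typeMap θ (pullType R.Φ σ₀) = s.1 ∧ (θ (translate σ₀ R.p)).2 = s.2.1 ∧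
      (θ (translate σ₀ R.p')).2 = s.2.2)
    (h : ∀ f ∈ 𝒮, ∃ ι₁ : K →+* ℂ, f.Admissible ι₁ ∧ ∃ (V : HermSpace3 K ι₁) (σ : K →+* ℂ),
      (Model.picardCMUniverse exists_isReal_hodgeModel_holds hodgePQ_independent_of_hodgeModel_holds
        BallQuotient.ballQuotientUniformised_holds cmAbelianVarietyRealised_holds).PeriodNV ι₁ V K f.psi σ)
    {P B : AbelianVariety ℂ} (hP : AbelianVariety.IsProductOf (fun B : AbelianVariety ℂ =>
      ∃ (E : Type) (_ : Field E) (_ : NumberField E) (_ : IsCMField E) (_ : E →+* (K : Type)) (Φ : CMType E)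
        (ι : 𝓞 E →+* End B) (θ : E →+* Module.End ℂ (complexBetti B.X 1)),
        IsCMTypeRealisation Φ B ι θ) P)
    (hB : AVDominatedBy B P) : HodgeConjectureFor B.dim B.X :=
  hodgeConjectureFor_of_avDominatedBy_isProductOf_of_exists_facePeriod_on K (six_le_finrank_of_datum K hA θ) 𝒮 σ₀
    (hgen_of_hodge_le θ hθ hc S hS σ₀ 𝒮 hreads) h hP hB

/-- **THE ODD-SLICE TRANSPORT, CLOSED — finite-face-set form.**  Under a generation statement for a label family `S` with distinct
places in b09's model, there EXISTS a finite set `𝒮` of at most `|S|` faces of `K` (one reading each member of `S`) such that ONE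
period witness per face of `𝒮` implies the Hodge conjecture for every complex abelian variety dominated by a finite product of
abelian varieties realising CM types of CM fields embeddable in `K`.  (FRAMING: conditional; `HC_CM` is not proved.)
[cite: Shimura1998, §6.2 Theorem 3 and §6.1 Corollary of Theorem 2 (pp. 41–43)] [cite: Pohlmann1968, Thm. 1]
[cite: Milne1999LefschetzClasses, Thm. 3.2 and Cor. 4.5] [cite: MumfordAV1970, §19 Thm. 1 and p. 169] -/
theorem exists_faceSet_of_oddSlice (K : CMField) [hGal : IsGalois ℚ K]
    (hA : 3 ≤ Fintype.card A) (θ : GalT K ≃ ZMod 2 × A) (hθ : ∀ P Q : GalT K, θ (P * Q) = θ P + θ Q) (hc : θ conjT = (1, 0))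
    (S : Finset (Ty A × A × A)) (hS' : ∀ s ∈ S, s.2.1 ≠ s.2.2)
    (hS : hodge A ≤ pairs A ⊔
      Submodule.span ℤ {w : Ty A → ℤ | ∃ g : ZMod 2 × A, ∃ s ∈ S, w = transl A g (faceVec A s.1 s.2.1 s.2.2)})
    (σ₀ : (K : Type) →+* ℂ) :
    ∃ 𝒮 : Finset (Face K), 𝒮.card ≤ S.card ∧
      ((∀ f ∈ 𝒮, ∃ ι₁ : K →+* ℂ, f.Admissible ι₁ ∧ ∃ (V : HermSpace3 K ι₁) (σ : K →+* ℂ),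
        (Model.picardCMUniverse exists_isReal_hodgeModel_holds hodgePQ_independent_of_hodgeModel_holds
          BallQuotient.ballQuotientUniformised_holds cmAbelianVarietyRealised_holds).PeriodNV ι₁ V K f.psi σ) →
      ∀ {P B : AbelianVariety ℂ}, AbelianVariety.IsProductOf (fun B : AbelianVariety ℂ =>
        ∃ (E : Type) (_ : Field E) (_ : NumberField E) (_ : IsCMField E) (_ : E →+* (K : Type)) (Φ : CMType E)
          (ι : 𝓞 E →+* End B) (θ : E →+* Module.End ℂ (complexBetti B.X 1)),
          IsCMTypeRealisation Φ B ι θ) P →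
      AVDominatedBy B P → HodgeConjectureFor B.dim B.X) := by
  obtain ⟨𝒮, hcard, hreads⟩ := exists_faces_read θ hθ hc σ₀ S hS'
  refine ⟨𝒮, hcard, fun h P B hP hB => ?_⟩
  exact hodgeConjectureFor_of_avDominatedBy_isProductOf_of_exists_facePeriod_of_oddSlice K hA θ hθ hc S hS σ₀ (𝒮 : Set (Face K))
    (fun s hs => by obtain ⟨R, hR, hr⟩ := hreads s hs; exact ⟨R, Finset.mem_coe.mpr hR, hr⟩)
    (fun f hf => h f (Finset.mem_coe.mp hf)) hP hB

end GalTDatum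

/-! ## §2 `Aut`-datum -/

section AutDatum

variable {A : Type} [AddCommGroup A] [Fintype A] [DecidableEq A]

/-- **THE ODD-SLICE TRANSPORT, CLOSED — `Aut`-datum form.**  What a field seat supplies: a Galois CM field `K`; a bijection
`ε : Aut(K) ≃ ℤ/2 × A` (`|A| ≥ 3`) multiplicative-to-additive; a base embedding `σ₀` and the automorphism `c` inducing complex
conjugation at `σ₀` with `ε c = (1, 0)`; a label family `S` generating the Hodge lattice of b09's model together with the pairs; faces
`R ∈ 𝒮` reading the members `(φ; i, j)` of `S` through `ε` — `σ₀ ∘ x ∈ R.Φ ↔ (ε x).1 = φ (ε x).2`, `R.p = σ₀ ∘ x_p` with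
`(ε x_p).2 = i`, `R.p′ = σ₀ ∘ x_q` with `(ε x_q).2 = j` —; ONE period witness per face of `𝒮`.  Output: the Hodge conjecture for every
complex abelian variety dominated by a finite product of abelian varieties realising CM types of CM fields embeddable in `K`.
(FRAMING: conditional; `HC_CM` is not proved.)
[cite: Shimura1998, §6.2 Theorem 3 and §6.1 Corollary of Theorem 2 (pp. 41–43)] [cite: Pohlmann1968, Thm. 1]
[cite: Milne1999LefschetzClasses, Thm. 3.2 and Cor. 4.5] [cite: MumfordAV1970, §19 Thm. 1 and p. 169] -/
theorem hodgeConjectureFor_of_avDominatedBy_isProductOf_of_exists_facePeriod_of_oddSlice_aut (K : CMField) [hGal : IsGalois ℚ K]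
    (hA : 3 ≤ Fintype.card A) (σ₀ : (K : Type) →+* ℂ) (ε : ((K : Type) ≃ₐ[ℚ] (K : Type)) ≃ ZMod 2 × A)
    (hε : ∀ x y : ((K : Type) ≃ₐ[ℚ] (K : Type)), ε (x * y) = ε x + ε y)
    {c : ((K : Type) ≃ₐ[ℚ] (K : Type))} (hcσ : σ₀.comp (c : (K : Type) →+* (K : Type)) = conjugate σ₀) (hεc : ε c = (1, 0))
    (S : Finset (Ty A × A × A))
    (hS : hodge A ≤ pairs A ⊔
      Submodule.span ℤ {w : Ty A → ℤ | ∃ g : ZMod 2 × A, ∃ s ∈ S, w = transl A g (faceVec A s.1 s.2.1 s.2.2)})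
    (𝒮 : Set (Face K))
    (hreads : ∀ s ∈ S, ∃ R ∈ 𝒮,
      (∀ x : ((K : Type) ≃ₐ[ℚ] (K : Type)), σ₀.comp (x : (K : Type) →+* (K : Type)) ∈ R.Φ.1 ↔ (ε x).1 = s.1 (ε x).2) ∧
      (∃ x : ((K : Type) ≃ₐ[ℚ] (K : Type)), R.p = σ₀.comp (x : (K : Type) →+* (K : Type)) ∧ (ε x).2 = s.2.1) ∧
      (∃ x : ((K : Type) ≃ₐ[ℚ] (K : Type)), R.p' = σ₀.comp (x : (K : Type) →+* (K : Type)) ∧ (ε x).2 = s.2.2))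
    (h : ∀ f ∈ 𝒮, ∃ ι₁ : K →+* ℂ, f.Admissible ι₁ ∧ ∃ (V : HermSpace3 K ι₁) (σ : K →+* ℂ),
      (Model.picardCMUniverse exists_isReal_hodgeModel_holds hodgePQ_independent_of_hodgeModel_holds
        BallQuotient.ballQuotientUniformised_holds cmAbelianVarietyRealised_holds).PeriodNV ι₁ V K f.psi σ)
    {P B : AbelianVariety ℂ} (hP : AbelianVariety.IsProductOf (fun B : AbelianVariety ℂ =>
      ∃ (E : Type) (_ : Field E) (_ : NumberField E) (_ : IsCMField E) (_ : E →+* (K : Type)) (Φ : CMType E)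
        (ι : 𝓞 E →+* End B) (θ : E →+* Module.End ℂ (complexBetti B.X 1)),
        IsCMTypeRealisation Φ B ι θ) P)
    (hB : AVDominatedBy B P) : HodgeConjectureFor B.dim B.X := by
  obtain ⟨hθ, hc⟩ := autDatum σ₀ ε hε hcσ hεc
  refine hodgeConjectureFor_of_avDominatedBy_isProductOf_of_exists_facePeriod_of_oddSlice K hA ((galTOfAut σ₀).symm.trans ε)
    hθ hc S hS σ₀ 𝒮 (fun s hs => ?_) h hP hB
  obtain ⟨R, hR, hΦ, ⟨xp, hp, hxp⟩, ⟨xq, hq, hxq⟩⟩ := hreads s hs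
  refine ⟨R, hR, typeMap_eq_of_autReads σ₀ ε R.Φ hΦ, ?_, ?_⟩
  · rw [hp, autDatum_translate, hxp]
  · rw [hq, autDatum_translate, hxq]

end AutDatum

/-! ## §3 Cyclic fields: the datum from ONE generator -/

section Generator

/-- In `ℤ/2 × ℤ/m`, `m` odd, the only non-zero element killed by `2` is `(1, 0)`. [folklore] -/
theorem zmod_two_prod_involution {m : ℕ} [NeZero m] (hm : Odd m) (v : ZMod 2 × ZMod m) (hv : v ≠ 0) (h2 : v + v = 0) :
    v = (1, 0) := by
  obtain ⟨a, b⟩ := v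
  have hb : b = 0 := by
    have h2' : (2 : ZMod m) * b = 0 := by
      rw [two_mul]; exact congrArg Prod.snd h2
    have hu : IsUnit (2 : ZMod m) := by
      have hcop : Nat.Coprime 2 m := (Nat.coprime_two_left.mpr hm)
      have := (ZMod.unitOfCoprime 2 hcop).isUnit
      rwa [ZMod.coe_unitOfCoprime, Nat.cast_ofNat] at this
    exact (hu.mul_right_eq_zero).mp h2'
  subst hb
  have ha : a ≠ 0 := fun ha => hv (by rw [ha]; rfl)
  have key : ∀ u : ZMod 2, u ≠ 0 → u = 1 := by decide
  rw [key a ha]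

/-- **The `Aut`-datum of a cyclic CM field from ONE generator.**  `K` Galois CM of degree `2m`, `m` odd, with `Aut(K)` generated by
`g`: there is a bijection `ε : Aut(K) ≃ ℤ/2 × ℤ/m`, multiplicative-to-additive, reading `g ^ k ↦ (k, k)`, under which THE automorphism
inducing complex conjugation at any `σ₀` reads `(1, 0)` — proved, not assumed: it is the unique involution
(`zmodMulEquivOfGenerator`, Chinese remainder, `zmod_two_prod_involution`). [folklore] -/
theorem exists_autDatum_of_generator (K : CMField) [IsGalois ℚ K] {m : ℕ} [NeZero m] (hm : Odd m)
    (hK : Module.finrank ℚ (K : Type) = 2 * m) {g : ((K : Type) ≃ₐ[ℚ] (K : Type))} (hg : ∀ x, x ∈ Subgroup.zpowers g)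
    (σ₀ : (K : Type) →+* ℂ) :
    ∃ ε : ((K : Type) ≃ₐ[ℚ] (K : Type)) ≃ ZMod 2 × ZMod m,
      (∀ x y : ((K : Type) ≃ₐ[ℚ] (K : Type)), ε (x * y) = ε x + ε y) ∧
      (∀ k : ℕ, ε (g ^ k) = ((k : ZMod 2), (k : ZMod m))) ∧
      ∀ c : ((K : Type) ≃ₐ[ℚ] (K : Type)), σ₀.comp (c : (K : Type) →+* (K : Type)) = conjugate σ₀ → ε c = (1, 0) := by
  have hn : Nat.card ((K : Type) ≃ₐ[ℚ] (K : Type)) = 2 * m := (IsGalois.card_aut_eq_finrank ℚ (K : Type)).trans hK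
  have hcop : Nat.Coprime 2 m := (Nat.coprime_two_left.mpr hm)
  let e₁ : ((K : Type) ≃ₐ[ℚ] (K : Type)) ≃ ZMod (2 * m) :=
    (zmodMulEquivOfGenerator hg hn).symm.toEquiv.trans Multiplicative.toAdd
  let ε : ((K : Type) ≃ₐ[ℚ] (K : Type)) ≃ ZMod 2 × ZMod m := e₁.trans (ZMod.chineseRemainder hcop).toEquiv
  have hεapp : ∀ x, ε x = ZMod.chineseRemainder hcop (Multiplicative.toAdd ((zmodMulEquivOfGenerator hg hn).symm x)) :=
    fun x => rfl
  have hε : ∀ x y : ((K : Type) ≃ₐ[ℚ] (K : Type)), ε (x * y) = ε x + ε y := fun x y => by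
    rw [hεapp, hεapp, hεapp, map_mul, toAdd_mul, map_add]
  refine ⟨ε, hε, fun k => ?_, fun c hcσ => ?_⟩
  · rw [hεapp, ← zpow_natCast, zmodMulEquivOfGenerator_symm_apply_zpow, toAdd_ofAdd, Int.cast_natCast, map_natCast]
    ext
    · rw [Prod.fst_natCast]
    · rw [Prod.snd_natCast]
  · obtain ⟨h0, h2⟩ := FaceCensus.involution_of_map_add ε ε.injective hε (FaceCensus.conjAut_mul_self σ₀ hcσ)
      (FaceCensus.conjAut_ne_one σ₀ hcσ)
    exact zmod_two_prod_involution hm (ε c) h0 h2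

/-- **THE ODD-SLICE TRANSPORT, CLOSED — cyclic fields, from ONE generator (headline for `ℚ(ζ₁₉)`, `ℚ(ζ₂₇)`, `ℚ(ζ₂₃)`, `ℚ(ζ₃₁)`, …).**
What a field seat supplies: a Galois CM field `K` with `finrank ℚ K = 2m`, `m ≥ 3` odd; ONE generator `g` of `Aut(K)`; a base
embedding `σ₀`; a label family `S ⊆ (ℤ/m → ℤ/2) × ℤ/m × ℤ/m` generating the Hodge lattice of b09's model of `(ℤ/2 × ℤ/m, (1,0))`
together with the pairs; faces `R ∈ 𝒮` reading the members `(φ; i, j)` of `S` through `g`-powers — `σ₀ ∘ g^k ∈ R.Φ ↔ (k : ℤ/2) = φ k`,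
`R.p = σ₀ ∘ g^a` with `a ≡ i`, `R.p′ = σ₀ ∘ g^b` with `b ≡ j` —; ONE period witness per face of `𝒮`.  Complex conjugation is `g^m`
automatically.  Output: the Hodge conjecture for every complex abelian variety dominated by a finite product of abelian varieties
realising CM types of CM fields embeddable in `K`.  (FRAMING: conditional; `HC_CM` is not proved.)
[cite: Shimura1998, §6.2 Theorem 3 and §6.1 Corollary of Theorem 2 (pp. 41–43)] [cite: Pohlmann1968, Thm. 1]
[cite: Milne1999LefschetzClasses, Thm. 3.2 and Cor. 4.5] [cite: MumfordAV1970, §19 Thm. 1 and p. 169] -/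
theorem hodgeConjectureFor_of_avDominatedBy_isProductOf_of_exists_facePeriod_of_oddSlice_gen (K : CMField) [hGal : IsGalois ℚ K]
    {m : ℕ} [NeZero m] (hm : Odd m) (h3 : 3 ≤ m) (hK : Module.finrank ℚ (K : Type) = 2 * m)
    {g : ((K : Type) ≃ₐ[ℚ] (K : Type))} (hg : ∀ x, x ∈ Subgroup.zpowers g) (σ₀ : (K : Type) →+* ℂ)
    (S : Finset (Ty (ZMod m) × ZMod m × ZMod m))
    (hS : hodge (ZMod m) ≤ pairs (ZMod m) ⊔
      Submodule.span ℤ {w : Ty (ZMod m) → ℤ | ∃ x : ZMod 2 × ZMod m, ∃ s ∈ S,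
        w = transl (ZMod m) x (faceVec (ZMod m) s.1 s.2.1 s.2.2)})
    (𝒮 : Set (Face K))
    (hreads : ∀ s ∈ S, ∃ R ∈ 𝒮,
      (∀ k : ℕ, σ₀.comp ((g ^ k : ((K : Type) ≃ₐ[ℚ] (K : Type))) : (K : Type) →+* (K : Type)) ∈ R.Φ.1 ↔
        (k : ZMod 2) = s.1 (k : ZMod m)) ∧
      (∃ a : ℕ, R.p = σ₀.comp ((g ^ a : ((K : Type) ≃ₐ[ℚ] (K : Type))) : (K : Type) →+* (K : Type)) ∧ (a : ZMod m) = s.2.1) ∧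
      (∃ b : ℕ, R.p' = σ₀.comp ((g ^ b : ((K : Type) ≃ₐ[ℚ] (K : Type))) : (K : Type) →+* (K : Type)) ∧ (b : ZMod m) = s.2.2))
    (h : ∀ f ∈ 𝒮, ∃ ι₁ : K →+* ℂ, f.Admissible ι₁ ∧ ∃ (V : HermSpace3 K ι₁) (σ : K →+* ℂ),
      (Model.picardCMUniverse exists_isReal_hodgeModel_holds hodgePQ_independent_of_hodgeModel_holds
        BallQuotient.ballQuotientUniformised_holds cmAbelianVarietyRealised_holds).PeriodNV ι₁ V K f.psi σ)
    {P B : AbelianVariety ℂ} (hP : AbelianVariety.IsProductOf (fun B : AbelianVariety ℂ =>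
      ∃ (E : Type) (_ : Field E) (_ : NumberField E) (_ : IsCMField E) (_ : E →+* (K : Type)) (Φ : CMType E)
        (ι : 𝓞 E →+* End B) (θ : E →+* Module.End ℂ (complexBetti B.X 1)),
        IsCMTypeRealisation Φ B ι θ) P)
    (hB : AVDominatedBy B P) : HodgeConjectureFor B.dim B.X := by
  have hn : Nat.card ((K : Type) ≃ₐ[ℚ] (K : Type)) = 2 * m := (IsGalois.card_aut_eq_finrank ℚ (K : Type)).trans hK
  obtain ⟨ε, hε, hread, hconj⟩ := exists_autDatum_of_generator K hm hK hg σ₀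
  obtain ⟨c, hcσ⟩ := FaceCensus.exists_conjAut σ₀
  have hA : 3 ≤ Fintype.card (ZMod m) := by rw [ZMod.card]; exact h3
  refine hodgeConjectureFor_of_avDominatedBy_isProductOf_of_exists_facePeriod_of_oddSlice_aut K hA σ₀ ε hε hcσ (hconj c hcσ)
    S hS 𝒮 (fun s hs => ?_) h hP hB
  obtain ⟨R, hR, hΦ, ⟨a, hp, ha⟩, ⟨b, hq, hb⟩⟩ := hreads s hs
  refine ⟨R, hR, fun x => ?_, ⟨g ^ a, hp, by rw [hread, ← ha]⟩, ⟨g ^ b, hq, by rw [hread, ← hb]⟩⟩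
  obtain ⟨k, rfl⟩ := FaceCensus.exists_pow_eq_of_generator hg hn x
  rw [hΦ, hread]

end Generator

end Summit.HodgeConjecture.CorCM

end
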